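import Summits.CriticalPhenomena.CardyFormulaZ2.Theorems.CardyGluingRDEPolygonReductionLatticePolygonGrid
import Summits.CriticalPhenomena.CardyFormulaZ2.Theorems.CardyGluingRDEPolygonReductionLatticeCells

/-!
# Lattice Jordan polygons with lattice marks uniformly close to a given conformal rectangle

Support file for `PolygonReduction` / `Assembly` (routes CardyGluingRDE / CardyPolygonWords of
`CardyFormulaZ2`, item stmt-CriticalPhenomena-4784): **every conformal rectangle `D` admits, for
every `ε, τ > 0`, a conformal rectangle `P` whose carrier is the interior of a finite union of
closed cells of a lattice `dℤ²`, whose four marked points are points of `dℤ²`, whose marks are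
`τ`-close to those of `D` and whose boundary loop is uniformly `ε`-close to that of `D`**
(`exists_latticePolygon_close`; `exists_latticePolygon_close_of_cells` takes the cells clause as
a hypothesis, discharged by `JordanDomain.exists_carrier_eq_interior_cells`).
Proof. The construction of `exists_rectilinear_close` (shadowing lattice walk at mesh `h`, loop
erasure, re-timing `ρ` through the knots) is repeated verbatim: it yields the Jordan loop
`γ = polygonLoop l ∘ ρ` of a simple closed LATTICE cycle `l ⊆ hℤ²`, `dist (γ s) (∂D s) ≤ ε`, whose
range lies on the grid lines of mesh `h/N` (cells clause). The marks are moved forward to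
`m_i = ρ⁻¹(⌈MNρ(mark_i)⌉/(MN))` (`M` vertices, `N` large): there the loop sits on `(h/N)ℤ²`
(`polygonLoop_mem_fineLattice`), and the new marks stay increasing, in `[0,1)`, `τ`-close.
-/

noncomputable section

namespace Summit.CriticalPhenomena.CardyFormulaZ2.Theorems

namespace LatticePolygonApproximation

open Set Metric Complex Filter Topology
open Literature.Probability.LatticeModels Literature.Probability.RandomPlanarGeometry
open Literature.Probability.Percolation (dist_meshPoint_of_adj)

/-- **Lattice-polygon approximation of conformal rectangles, with lattice marks.** See the module
docstring. The cells clause is supplied by the hypothesis `hcells`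
(`JordanDomain.exists_carrier_eq_interior_cells`). [folklore] -/
theorem exists_latticePolygon_close_of_cells
    (hcells : ∀ (J : JordanDomain) {d : ℝ}, 0 < d →
      frontier J.carrier ⊆ {z : ℂ | (∃ k : ℤ, z.re = d * k) ∨ ∃ k : ℤ, z.im = d * k} →
      ∃ s : Finset (ℤ × ℤ), J.carrier = interior (⋃ p ∈ s,
        {z : ℂ | d * (p.1 : ℝ) ≤ z.re ∧ z.re ≤ d * ((p.1 : ℝ) + 1) ∧
          d * (p.2 : ℝ) ≤ z.im ∧ z.im ≤ d * ((p.2 : ℝ) + 1)}))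
    (D : ConformalRectangle) {ε τ : ℝ} (hε : 0 < ε) (hτ : 0 < τ) :
    ∃ (P : ConformalRectangle) (d : ℝ), 0 < d ∧
      (∃ s : Finset (ℤ × ℤ), P.carrier = interior (⋃ p ∈ s,
        {z : ℂ | d * (p.1 : ℝ) ≤ z.re ∧ z.re ≤ d * ((p.1 : ℝ) + 1) ∧
          d * (p.2 : ℝ) ≤ z.im ∧ z.im ≤ d * ((p.2 : ℝ) + 1)})) ∧
      (∀ i, ∃ m n : ℤ, P.pt i = (d : ℂ) * ((m : ℂ) + (n : ℂ) * Complex.I)) ∧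
      (∀ i, |P.mark i - D.mark i| ≤ τ) ∧
      ∀ s, dist (P.boundary s) (D.boundary s) ≤ ε := by
  classical
  set β := D.boundary with hβ
  -- the parameter scale `L`
  obtain ⟨τ₁, hτ₁, -, hτ₁ε⟩ := D.toJordanDomain.exists_forall_dist_boundary_lt (ε := ε / 3) (by positivity)
  set L := min (τ₁ / 3) (1 / 12) with hLdef
  have hL0 : 0 < L := by rw [hLdef]; positivity
  have hL12 : L ≤ 1 / 12 := min_le_right _ _
  have hL3 : 3 * L ≤ τ₁ := by have := min_le_left (τ₁ / 3) (1 / 12); rw [hLdef]; linarith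
  -- the bottleneck `m` and the mesh `h`
  obtain ⟨m, hm, hbot⟩ := D.toJordanDomain.exists_pos_le_dist_boundary hL0 (by linarith)
  set h := min (ε / 6) (m / 7) with hhdef
  have hh0 : 0 < h := by rw [hhdef]; positivity
  have hh6 : 6 * h < m := by have := min_le_right (ε / 6) (m / 7); rw [hhdef]; linarith
  have hhε : h ≤ ε / 6 := min_le_left _ _
  -- the shadowing walk
  obtain ⟨n, F, hn, hF0, hFn, hFn2, hFrange, hFstep, hFshadow⟩ :=
    exists_shadow_walk D.toJordanDomain hh0 hL0
  set T : List (Site 2 × ℝ) := List.ofFn (fun j : Fin n => F ((j : ℕ) + 1)) with hT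
  have hTlen : T.length = n := by rw [hT, List.length_ofFn]
  have hTget : ∀ (i : ℕ) (hi : i < T.length), T[i] = F (i + 1) := fun i hi => by
    simp only [hT, List.getElem_ofFn]
  have hmem : ∀ x ∈ [F 0] ++ T, ∃ j, j ≤ n ∧ x = F j := by
    intro x hx
    rcases List.mem_append.1 hx with h1 | h1
    · exact ⟨0, Nat.zero_le _, List.mem_singleton.1 h1⟩
    · rw [hT, List.mem_ofFn] at h1
      obtain ⟨j, rfl⟩ := h1
      exact ⟨j + 1, by omega, rfl⟩
  -- coincidences of sites force circular closeness of parameters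
  have hbottle : ∀ x ∈ [F 0] ++ T, ∀ y ∈ [F 0] ++ T, x.1 = y.1 →
      |y.2 - x.2| < L ∨ 1 - L < |y.2 - x.2| := by
    intro x hx y hy hxy
    obtain ⟨j, hj, rfl⟩ := hmem x hx
    obtain ⟨j', hj', rfl⟩ := hmem y hy
    have hd : dist (β (F j).2) (β (F j').2) < m := by
      have h1 := hFshadow j hj
      have h2 := hFshadow j' hj'
      rw [← hxy] at h2
      have := dist_triangle (β (F j).2) (meshPoint h (F j).1) (β (F j').2)
      rw [dist_comm] at h1
      linarith
    by_contra hcon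
    push Not at hcon
    obtain ⟨h1, h2⟩ := hcon
    rcases le_or_gt (F j).2 (F j').2 with hle | hle
    · rw [abs_of_nonneg (by linarith)] at h1 h2
      have := hbot _ _ h1 h2
      linarith
    · rw [abs_of_neg (by linarith)] at h1 h2
      have := hbot (F j').2 (F j).2 (by linarith) (by linarith)
      rw [dist_comm] at this
      linarith
  -- loop erasure with the stopping rule
  obtain ⟨q, hq, hsub, hnodup, hchain, hcl, hlt1, hdef, hhead, hlast⟩ :=
    exists_cycle_of_walk (zdGraph 2).Adj hL0 (by linarith) T [F 0] (by simp)
      (fun i j hi hj _ => by simp at hi hj; omega)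
      (fun i hi => absurd hi (by simp))
      (fun i hi => by
        rw [hTget, hTget]
        have := hFstep (i + 1) (by rw [hTlen] at hi; omega)
        exact this)
      (fun h0 => by
        simp only [List.getLast_singleton]
        rw [hTget]
        have := hFstep 0 hn
        simp only [zero_add] at this ⊢
        exact ⟨this.1, this.2.1, by linarith [this.2.2]⟩)
      hbottle
      (fun x hx => by obtain ⟨j, hj, rfl⟩ := hmem x hx; exact hFrange j hj)
      (by
        have hTne : T ≠ [] := List.ne_nil_of_length_pos (by rw [hTlen]; exact hn)
        refine ⟨hTne, ?_, ?_⟩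
        · rw [List.getLast_eq_getElem, hTget, List.head_cons]
          simp only [hTlen, Nat.sub_add_cancel hn]
          exact hFn
        · rw [List.getLast_eq_getElem, hTget, List.head_cons, hF0]
          simp only [hTlen, Nat.sub_add_cancel hn]
          linarith)
  set M := q.length with hMdef
  have hM0 : 0 < M := List.length_pos_iff.2 hq
  have hqlast : q.getLast hq = q[M - 1] := List.getLast_eq_getElem hq
  have hqhead : q.head hq = q[0] := List.head_eq_getElem hq
  rw [hqlast] at hcl hlt1 hdef hlast
  rw [hqhead] at hcl hlt1 hdef hhead
  -- the cycle is long: `M ≥ 4`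
  have hgrow : ∀ (k : ℕ) (hk : k < M), (q[k]).2 < L + k * (2 * L) := by
    intro k
    induction k with
    | zero => intro hk; simpa using hhead
    | succ k ih =>
      intro hk
      have := (hchain k hk).2.2
      have := ih (by omega)
      push_cast
      linarith
  have hM4 : 4 ≤ M := by
    by_contra hM
    push Not at hM
    have := hgrow (M - 1) (by omega)
    have hk : ((M - 1 : ℕ) : ℝ) ≤ 2 := by
      have : M - 1 ≤ 2 := by omega
      exact_mod_cast this
    nlinarith
  -- the sites and the drawn polygon
  set qs : List (Site 2) := q.map Prod.fst with hqs
  have hqslen : qs.length = M := by rw [hqs, List.length_map]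
  have hqsget : ∀ (i : ℕ) (hi : i < qs.length), qs[i] = (q[i]'(by rw [hqslen] at hi; exact hi)).1 :=
    fun i hi => List.getElem_map _
  have hadjc : ∀ (i : ℕ) (hi : i < qs.length),
      (zdGraph 2).Adj qs[i] (qs[(i + 1) % qs.length]'(Nat.mod_lt _ (by omega))) := by
    intro i hi
    rw [hqsget, hqsget]
    by_cases hi1 : i + 1 < M
    · simp only [hqslen, Nat.mod_eq_of_lt hi1]
      exact (hchain i hi1).1
    · have hiM : i = M - 1 := by rw [hqslen] at hi; omega
      subst hiM
      simp only [hqslen, Nat.sub_add_cancel hM0, Nat.mod_self]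
      exact hcl
  have hnodupqs : ∀ (i j : ℕ) (hi : i < qs.length) (hj : j < qs.length), qs[i] = qs[j] → i = j := by
    intro i j hi hj hij
    rw [hqsget, hqsget] at hij
    exact hnodup i j _ _ hij
  set l : List ℂ := qs.map (meshPoint h) with hl
  have hllen : l.length = M := by rw [hl, List.length_map, hqslen]
  have hlget : ∀ (i : ℕ) (hi : i < l.length), l[i] = meshPoint h (q[i]'(by rw [hllen] at hi; exact hi)).1 := by
    intro i hi; simp only [hl, hqs, List.getElem_map]
  have hsimple : IsSimpleClosedPolygon l :=
    isSimpleClosedPolygon_meshCycle hh0 (by rw [hqslen]; omega) hnodupqs hadjc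
  obtain ⟨S, hS, hScover⟩ := exists_axisParallel_cover (h := h) (by rw [hqslen]; exact hM0) hadjc
  -- the knots and the reparametrisation
  set θ : ℕ → ℝ := fun i => if hi : i < M then (q[i]).2 else 0 with hθdef
  have hθq : ∀ (i : ℕ) (hi : i < M), θ i = (q[i]).2 := fun i hi => by simp [hθdef, hi]
  have hθmono : ∀ i, i + 1 < M → θ i < θ (i + 1) := fun i hi => by
    rw [hθq i (by omega), hθq (i + 1) hi]; exact (hchain i hi).2.1
  have hθwrap : θ (M - 1) < θ 0 + 1 := by
    rw [hθq _ (by omega), hθq 0 hM0]; exact hlt1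
  obtain ⟨ρ, hρc, hρm, hρs, hρ1, hρθ⟩ := exists_reparam hM0 θ hθmono hθwrap
  have hρ01 : ρ 1 = ρ 0 + 1 := by have := hρ1 0; rwa [zero_add] at this
  -- the re-timed polygon loop
  set γ : ℝ → ℂ := fun s => polygonLoop l (ρ s) with hγdef
  have hγc : Continuous γ := (continuous_polygonLoop l).comp hρc
  have hγp : Function.Periodic γ 1 := fun s => by
    simp only [hγdef]; rw [hρ1]; exact periodic_polygonLoop l (ρ s)
  have hγinj : InjOn γ (Ico 0 1) := by
    intro s hs t ht hst
    simp only [hγdef] at hst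
    have h1 : polygonLoop l (Int.fract (ρ s)) = polygonLoop l (Int.fract (ρ t)) := by
      rw [polygonLoop_fract, polygonLoop_fract]; exact hst
    have h2 : Int.fract (ρ s) = Int.fract (ρ t) :=
      injOn_polygonLoop hsimple ⟨Int.fract_nonneg _, Int.fract_lt_one _⟩
        ⟨Int.fract_nonneg _, Int.fract_lt_one _⟩ h1
    obtain ⟨z, hz⟩ := Int.fract_eq_fract.1 h2
    have hs' : ρ 0 ≤ ρ s ∧ ρ s < ρ 0 + 1 := ⟨hρm.monotone hs.1, hρ01 ▸ hρm hs.2⟩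
    have ht' : ρ 0 ≤ ρ t ∧ ρ t < ρ 0 + 1 := ⟨hρm.monotone ht.1, hρ01 ▸ hρm ht.2⟩
    have hz0 : z = 0 := by
      have : |(z : ℝ)| < 1 := by rw [← hz, abs_lt]; constructor <;> linarith
      have : |z| < 1 := by exact_mod_cast this
      have := abs_lt.1 this
      omega
    rw [hz0, Int.cast_zero, sub_eq_zero] at hz
    exact hρm.injective hz
  have hclose : ∀ s, dist (γ s) (β s) ≤ ε := by
    intro s
    -- reduce to the period `[θ 0, θ 0 + 1)`
    set k : ℤ := ⌊s - θ 0⌋ with hk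
    set s' := s - k with hs'
    have hs'1 : θ 0 ≤ s' := by have := Int.floor_le (s - θ 0); rw [hs']; linarith
    have hs'2 : s' < θ 0 + 1 := by have := Int.lt_floor_add_one (s - θ 0); rw [hs']; linarith
    have hγs : γ s = γ s' := by
      rw [hs', show s - (k : ℝ) = s - k * (1 : ℝ) by ring]; exact (hγp.sub_int_mul_eq k).symm
    have hβs : β s = β s' := by
      rw [hs', show s - (k : ℝ) = s - k * (1 : ℝ) by ring]; exact (D.periodic_boundary.sub_int_mul_eq k).symm
    rw [hγs, hβs]
    -- locate the knot interval of `s'`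
    set Fi : Finset ℕ := (Finset.range M).filter fun i => θ i ≤ s' with hFi
    have hFine : Fi.Nonempty := ⟨0, by simp [hFi, hM0, hs'1]⟩
    set i := Fi.max' hFine with hidef
    have hiF : i ∈ Fi := Fi.max'_mem hFine
    have hiM : i < M := by have := (Finset.mem_filter.1 hiF).1; simpa using this
    have hθi : θ i ≤ s' := (Finset.mem_filter.1 hiF).2
    -- the next knot: its value `θn`, with `s' ≤ θn`, `θn - θ i < 3L`, `ρ θn = (i+1)/M`
    obtain ⟨θn, hsn, hgap, hρn⟩ : ∃ θn : ℝ, s' ≤ θn ∧ θn - θ i < 3 * L ∧ ρ θn = ((i : ℝ) + 1) / M := by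
      by_cases hi1 : i + 1 < M
      · refine ⟨θ (i + 1), ?_, ?_, ?_⟩
        · by_contra hlt
          push Not at hlt
          have hmem : i + 1 ∈ Fi := by
            simp only [hFi, Finset.mem_filter, Finset.mem_range]; exact ⟨hi1, hlt.le⟩
          have := Fi.le_max' _ hmem
          rw [← hidef] at this; omega
        · rw [hθq i hiM, hθq (i + 1) hi1]; linarith [(hchain i hi1).2.2]
        · rw [hρθ (i + 1) hi1]; push_cast; ring
      · have hiM' : i = M - 1 := by omega
        refine ⟨θ 0 + 1, hs'2.le, ?_, ?_⟩
        · rw [hiM', hθq (M - 1) (by omega), hθq 0 hM0]; linarith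
        · rw [hρ1, hρθ 0 hM0, hiM']
          have : ((M - 1 : ℕ) : ℝ) = M - 1 := by rw [Nat.cast_sub (by omega)]; simp
          rw [this]; field_simp; ring
    -- `ρ s'` lies in the `i`-th piece, so `γ s'` lies on the `i`-th edge
    have hρi : (i : ℝ) / M ≤ ρ s' := by rw [← hρθ i hiM]; exact hρm.monotone hθi
    have hρi' : ρ s' ≤ ((i : ℝ) + 1) / M := by rw [← hρn]; exact hρm.monotone hsn
    have hMr : (0 : ℝ) < M := by exact_mod_cast hM0
    set t := (M : ℝ) * ρ s' - i with ht
    have ht0 : 0 ≤ t := by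
      rw [ht]; have := (div_le_iff₀ hMr).1 hρi; linarith
    have ht1 : t ≤ 1 := by
      rw [ht]; have := (le_div_iff₀ hMr).1 hρi'; linarith
    have hil : i < l.length := by rw [hllen]; exact hiM
    have hγeq : γ s' = AffineMap.lineMap l[i] (l[(i + 1) % l.length]'(Nat.mod_lt _ (by omega))) t := by
      rw [← polygonLoop_apply_div hil ⟨ht0, ht1⟩]
      simp only [hγdef]
      congr 1
      rw [hllen, ht]; field_simp; ring
    have hedge : dist (γ s') (l[i]) ≤ h := by
      have hseg : γ s' ∈ segment ℝ (l[i]) (l[(i + 1) % l.length]'(Nat.mod_lt _ (by omega))) := by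
        rw [hγeq, segment_eq_image_lineMap]; exact mem_image_of_mem _ ⟨ht0, ht1⟩
      have h1 := mem_closedBall.1 (segment_subset_closedBall_left _ _ hseg)
      refine h1.trans (le_of_eq ?_)
      rw [hlget, hlget, dist_meshPoint_of_adj, abs_of_pos hh0]
      have := hadjc i (by rw [hqslen]; exact hiM)
      rw [hqsget, hqsget] at this
      simp only [hqslen, hllen] at this ⊢
      exact this
    -- the vertex is `3h`-close to `β (θ i)`, and `θ i` is `3L`-close to `s'`
    have hvert : dist (l[i]) (β (θ i)) ≤ 3 * h := by
      rw [hlget, hθq i hiM]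
      obtain ⟨j, hj, hqj⟩ := hmem _ (hsub _ (List.getElem_mem (by rw [← hMdef]; exact hiM)))
      rw [hqj]
      exact hFshadow j hj
    have hpar : dist (β (θ i)) (β s') < ε / 3 :=
      hτ₁ε _ _ (by rw [abs_of_nonpos (by linarith)]; linarith)
    have := dist_triangle4 (γ s') (l[i]) (β (θ i)) (β s')
    linarith

  set J := JordanDomain.ofLoop hγc hγp hγinj with hJ
  /- ### New part: lattice marks. Positive gaps of `ρ` at the marks: -/
  have hρlt : ∀ {a b : ℝ}, a < b → 0 < ρ b - ρ a := fun hab => sub_pos.2 (hρm hab)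
  have hm01 : ∀ i : Fin 4, 0 ≤ D.mark i ∧ D.mark i < 1 := fun i => ⟨(D.mark_mem i).1, (D.mark_mem i).2⟩
  have hmk01 : D.mark 0 < D.mark 1 := D.strictMono_mark (by decide)
  have hmk12 : D.mark 1 < D.mark 2 := D.strictMono_mark (by decide); have hmk23 : D.mark 2 < D.mark 3 := D.strictMono_mark (by decide)
  set g : ℝ := min (min (min (ρ (D.mark 1) - ρ (D.mark 0)) (ρ (D.mark 2) - ρ (D.mark 1)))
      (min (ρ (D.mark 3) - ρ (D.mark 2)) (ρ 1 - ρ (D.mark 3))))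
    (min (min (ρ (D.mark 0 + τ) - ρ (D.mark 0)) (ρ (D.mark 1 + τ) - ρ (D.mark 1)))
      (min (ρ (D.mark 2 + τ) - ρ (D.mark 2)) (ρ (D.mark 3 + τ) - ρ (D.mark 3)))) with hgdef
  have hg0 : 0 < g := by
    rw [hgdef]
    refine lt_min (lt_min (lt_min (hρlt hmk01) (hρlt hmk12)) (lt_min (hρlt hmk23) (hρlt (hm01 3).2)))
      (lt_min (lt_min (hρlt (by linarith)) (hρlt (by linarith)))
        (lt_min (hρlt (by linarith)) (hρlt (by linarith))))
  have hg01 : g ≤ ρ (D.mark 1) - ρ (D.mark 0) := by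
    rw [hgdef]; exact (min_le_left _ _).trans ((min_le_left _ _).trans (min_le_left _ _))
  have hg12 : g ≤ ρ (D.mark 2) - ρ (D.mark 1) := by
    rw [hgdef]; exact (min_le_left _ _).trans ((min_le_left _ _).trans (min_le_right _ _))
  have hg23 : g ≤ ρ (D.mark 3) - ρ (D.mark 2) := by
    rw [hgdef]; exact (min_le_left _ _).trans ((min_le_right _ _).trans (min_le_left _ _))
  have hg3 : g ≤ ρ 1 - ρ (D.mark 3) := by
    rw [hgdef]; exact (min_le_left _ _).trans ((min_le_right _ _).trans (min_le_right _ _))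
  have hgτ : ∀ i : Fin 4, g ≤ ρ (D.mark i + τ) - ρ (D.mark i) := by
    intro i
    fin_cases i
    · rw [hgdef]; exact (min_le_right _ _).trans ((min_le_left _ _).trans (min_le_left _ _))
    · rw [hgdef]; exact (min_le_right _ _).trans ((min_le_left _ _).trans (min_le_right _ _))
    · rw [hgdef]; exact (min_le_right _ _).trans ((min_le_right _ _).trans (min_le_left _ _))
    · rw [hgdef]; exact (min_le_right _ _).trans ((min_le_right _ _).trans (min_le_right _ _))
  -- the refinement factor `N`: `1/(M N) < g`
  have hMr : (0 : ℝ) < M := by exact_mod_cast hM0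
  set N : ℕ := ⌈1 / (M * g)⌉₊ + 1 with hNdef
  have hN0 : 0 < N := Nat.succ_pos _
  have hNr : (0 : ℝ) < N := by exact_mod_cast hN0
  have hMN : (0 : ℝ) < M * N := mul_pos hMr hNr
  have hMNg : 1 / ((M : ℝ) * N) < g := by
    rw [div_lt_iff₀ hMN]
    have h1 : 1 / ((M : ℝ) * g) ≤ ⌈1 / ((M : ℝ) * g)⌉₊ := Nat.le_ceil _
    have h2 : ((⌈1 / ((M : ℝ) * g)⌉₊ : ℕ) : ℝ) < N := by
      rw [hNdef]; push_cast; linarith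
    have h3 : 1 / ((M : ℝ) * g) < N := h1.trans_lt h2
    rw [div_lt_iff₀ (mul_pos hMr hg0)] at h3
    linarith
  -- the grid times `σ i` and the new marks `mk i`
  set σ : Fin 4 → ℝ := fun i => (⌈((M : ℝ) * N) * ρ (D.mark i)⌉ : ℝ) / (M * N) with hσdef
  have hσge : ∀ i, ρ (D.mark i) ≤ σ i := by
    intro i
    rw [hσdef]; dsimp only
    rw [le_div_iff₀ hMN]
    have := Int.le_ceil (((M : ℝ) * N) * ρ (D.mark i))
    linarith
  have hσlt : ∀ i, σ i < ρ (D.mark i) + g := by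
    intro i
    have h1 : σ i < ρ (D.mark i) + 1 / ((M : ℝ) * N) := by
      rw [hσdef]; dsimp only
      rw [div_lt_iff₀ hMN, add_mul, one_div, inv_mul_cancel₀ hMN.ne']
      have := Int.ceil_lt_add_one (((M : ℝ) * N) * ρ (D.mark i))
      linarith
    linarith
  have hσgrid : ∀ i, ∃ C : ℤ, σ i = C / (qs.length * N) := fun i =>
    ⟨⌈((M : ℝ) * N) * ρ (D.mark i)⌉, by rw [hqslen]⟩
  choose mk hmk using fun i => hρs (σ i)
  have hmk_ge : ∀ i, D.mark i ≤ mk i := fun i => hρm.le_iff_le.1 (by rw [hmk]; exact hσge i)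
  have hmk_lt : ∀ i, mk i < D.mark i + τ := fun i =>
    hρm.lt_iff_lt.1 (by rw [hmk]; linarith [hσlt i, hgτ i])
  have hmk_lt1 : ∀ i, mk i < 1 := by
    intro i
    refine hρm.lt_iff_lt.1 ?_
    rw [hmk]
    have h3 : ρ (D.mark i) ≤ ρ (D.mark 3) := hρm.monotone (D.strictMono_mark.monotone (Fin.le_last i))
    linarith [hσlt i]
  have hmk_mono : StrictMono mk := by
    refine Fin.strictMono_iff_lt_succ.2 fun i => hρm.lt_iff_lt.1 ?_
    rw [hmk, hmk]
    fin_cases i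
    · show σ 0 < σ 1
      linarith [hσlt 0, hσge 1, hg01]
    · show σ 1 < σ 2
      linarith [hσlt 1, hσge 2, hg12]
    · show σ 2 < σ 3
      linarith [hσlt 2, hσge 3, hg23]
  set P : ConformalRectangle := ⟨J, mk, hmk_mono, fun i => ⟨(hm01 i).1.trans (hmk_ge i), hmk_lt1 i⟩⟩ with hP
  -- the grid of the curve
  have hd0 : 0 < h / N := div_pos hh0 hNr
  have hgrid : frontier J.carrier ⊆ {z : ℂ | (∃ k : ℤ, z.re = h / N * k) ∨ ∃ k : ℤ, z.im = h / N * k} := by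
    rw [hJ, JordanDomain.frontier_ofLoop_carrier, show γ = polygonLoop l ∘ ρ from rfl, hρs.range_comp, hl]
    exact (range_polygonLoop_subset_gridLines (by rw [hqslen]; exact hM0) hadjc).trans (gridLines_mono hN0)
  obtain ⟨s, hs⟩ := hcells J hd0 hgrid
  refine ⟨P, h / N, hd0, ⟨s, hs⟩, fun i => ?_, fun i => ?_, fun s => hclose s⟩
  · -- lattice marks
    show ∃ m n : ℤ, γ (mk i) = ((h / N : ℝ) : ℂ) * ((m : ℂ) + (n : ℂ) * Complex.I)
    simp only [hγdef]
    rw [hmk i, hl]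
    exact polygonLoop_mem_fineLattice (by rw [hqslen]; exact hM0) hN0 (hσgrid i)
  · -- marks are `τ`-close
    show |mk i - D.mark i| ≤ τ
    rw [abs_of_nonneg (by linarith [hmk_ge i])]
    linarith [hmk_lt i]

/-- **Lattice-polygon approximation of conformal rectangles, with lattice marks** (module
docstring). [folklore] -/
theorem exists_latticePolygon_close (D : ConformalRectangle) {ε τ : ℝ} (hε : 0 < ε) (hτ : 0 < τ) :
    ∃ (P : ConformalRectangle) (d : ℝ), 0 < d ∧
      (∃ s : Finset (ℤ × ℤ), P.carrier = interior (⋃ p ∈ s,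
        {z : ℂ | d * (p.1 : ℝ) ≤ z.re ∧ z.re ≤ d * ((p.1 : ℝ) + 1) ∧
          d * (p.2 : ℝ) ≤ z.im ∧ z.im ≤ d * ((p.2 : ℝ) + 1)})) ∧
      (∀ i, ∃ m n : ℤ, P.pt i = (d : ℂ) * ((m : ℂ) + (n : ℂ) * Complex.I)) ∧
      (∀ i, |P.mark i - D.mark i| ≤ τ) ∧
      ∀ s, dist (P.boundary s) (D.boundary s) ≤ ε :=
  exists_latticePolygon_close_of_cells
    (fun J _ hd hgrid => J.exists_carrier_eq_interior_cells hd hgrid) D hε hτ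

end LatticePolygonApproximation

end Summit.CriticalPhenomena.CardyFormulaZ2.Theorems
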